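import Summits.Ventures.CertifiedManyBodySolver.Rows.RectMarginalNodesDominance
import Summits.Ventures.CertifiedManyBodySolver.HubbardAlg.GSWindowNodeD4Sound
import HarnessLib

/-!
# Square-lattice window-marginal nodes — part 4/4: §6  The ground-state-class node: LTI rows + `S^z = 0` row + local-stability (KKT / "EOM") rows,

HONEST FRAMING: first certified bounds; not a superconductivity verdict; every number certified or labelled float.
This module proves SOUNDNESS / DOMINANCE statements (inequalities between relaxations); it certifies no new number.

Continuation of `Rows/RectMarginalNodes.lean` (full module docstring, conventions, named gaps G-SYM-2D / G-ISO there). THIS module: §6 the ground-state-class node `LTIRectGSNode` (LTI + `S^z` + local-stability rows, `stabilityObs`) with its PROVED soundness `LTIRectGSNode.le_energyDensity2D` / cells and `LTIRectNode.gsNode`.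

FILING NOTE (sr-mbsolver-lit-4 g9, 2026-08-22): the four modules `Rows/RectMarginalNodes.lean` → `…Anderson.lean` → `…Dominance.lean` → `…GS.lean`
are sr-mbsolver-op-07 gen-11's PROVED HOME file `HOME/sr-mbsolver-op-07/lean/RectMarginalNodes.lean` (sha256 b7b18754ae1e5299…, 1 018 lines, 71 theorems +
15 defs, sorry-free; FILE REQUEST HOME INBOX l.4956, one-writer rule) split at its §3 / §5 / §6 headings to respect the gate's 400-line module
limit, with the working namespace `…CertifiedManyBodySolver.Sketch2D` renamed `Summit.Ventures.CertifiedManyBodySolver.Rows.RectMarginalNodes`; declarations,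
statements and proofs are otherwise VERBATIM except two gate-driven edits: op-07's `sum_polySite_eq` is replaced by the landed
`Rows.AndersonDominatedByLTI.sum_ofLex_eq'` and `re_expect_sum_numberOp` by the landed `HubbardAlg.GSWindowNodeD4Sound.expect_sum_numberOp` (dedup), two file-local
lemmas are `private`, and 24 one-line docstrings were added (lint.docstring). Contents by module: (1) §0 bookkeeping, §1 the TI dictionary (`bondEnergy` / `siteEnergy` / `densityC`, `expect_clusterHamiltonian`, `hubbardEnergyDensity_eq_re`), §2 `TIStateNode` + transport `TIStateNode.le_energyDensity2D`, tightness, cells `.m2EnergyLowerRow` / `.m3EnergyLowerRow`; (2) §3 the PROVED edge Anderson cluster floor ⇒ `TIStateNode` (`tiStateNode_of_andersonCluster_transposePair`, `tiStateNode_of_andersonRect`, instance `tiStateNode_of_rect2x4rot_opt_U8`) and §4 the matrix-level node `LTIRectNode` (`WindowLTI`, `hAvg`) with its PROVED soundness `LTIRectNode.tiStateNode` / `.m3EnergyLowerRow` / `.m2EnergyLowerRow`;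
(3) §5 the window-LTI matrix dictionary (`wfun`, `WindowLTI.wfun_*`, `wBond` / `wSite` / `wDens`) and the DOMINANCE edge `ltiRectNode_of_andersonCluster_subset` (+ `_andersonRect_subset`, `_andersonCluster_transposePair_subset`, instance `ltiRectNode_of_rect2x4rot_opt_U8`); (4) §6 the ground-state-class node `LTIRectGSNode` (LTI + `S^z` + local-stability rows, `stabilityObs`) with its PROVED soundness `LTIRectGSNode.le_energyDensity2D` / cells and `LTIRectNode.gsNode`.
-/

noncomputable section

open Matrix Complex Finset
open scoped ComplexOrder MatrixOrder BigOperators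
open Literature.Probability.LatticeModels
open Literature.MathematicalPhysics.QuantumLattice
open Literature.MathematicalPhysics.QuantumLattice.AndersonCluster
open Literature.MathematicalPhysics.QuantumLattice.HubbardWave0
open Literature.MathematicalPhysics.QuantumLattice.ThermodynamicLimit

namespace Summit.Ventures.CertifiedManyBodySolver.Rows.RectMarginalNodes

/-! ## §6  The ground-state-class node: LTI rows + `S^z = 0` row + local-stability (KKT / "EOM") rows,
      sound on the torus-limit class (I) (`le_energyDensity2D_of_forall_torusLimit`, `IsTorusLimitOf.localStability`) -/

section GroundStateClass

/-- The stability observable `Ãᴴ [H_{Λ⁺}, Ã]` of a local `A ∈ 𝔄_Λ` (`Λ⁺ = thicken Λ 1`, `Ã = Γ(Λ ↪ Λ⁺) A`). -/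
def stabilityObs (t U : ℝ) (Λ : Finset (Site 2)) (A : FermionOp Λ) : FermionOp (thicken Λ 1) :=
  (fermionEmbed (PolySite.incl (subset_thicken Λ 1)) A)ᴴ *
    ((hubbardFermionInteraction 2 t U).localHamiltonian (thicken Λ 1) *
        fermionEmbed (PolySite.incl (subset_thicken Λ 1)) A -
      fermionEmbed (PolySite.incl (subset_thicken Λ 1)) A *
        (hubbardFermionInteraction 2 t U).localHamiltonian (thicken Λ 1))

/-- **The ground-state-class LTI rectangle node** `LTIRectGSNode t U a b n lo`: the rows of `LTIRectNode` PLUS the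
`S^z = 0` rows `Re Tr ρ N_σ = ab·n/2` PLUS the Bratteli–Robinson local-stability rows
`0 ≤ Tr ρ Γ(Λ⁺ ↪ W)(Ãᴴ [H_{Λ⁺}, Ã])` (in `ℂ` with the `ComplexOrder`: real part `≥ 0`, imaginary part `= 0`) for
every region `Λ` with `Λ⁺ = thicken Λ 1 ⊆ W` and every local `A ∈ 𝔄_Λ` conserving the local particle number and
`S^z`.  These are the "EOM / KKT" rows of the bootstrap (efficiency lever L4): linear in `ρ`, a PSD condition on the
sesquilinear form `(A, B) ↦ Tr ρ Γ(Ãᴴ [H, B̃])` over the gauge-invariant operators of each `Λ`. -/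
def LTIRectGSNode (t U : ℝ) (a b : ℕ) (n lo : ℝ) : Prop :=
  ∀ ρ : FermionOp (rectWindow a b), ρ.PosSemidef → ρ.trace = 1 → WindowLTI ρ →
    ((ρ * totalNumber).trace).re = ((a : ℝ) * b) * n →
    (∀ σ : Fin 2, ((ρ * ∑ y : PolySite (rectWindow a b), numberOp y σ).trace).re = ((a : ℝ) * b) * (n / 2)) →
    (∀ (Λ : Finset (Site 2)) (hΛ : thicken Λ 1 ⊆ rectWindow a b) (A : FermionOp Λ),
        Commute A totalNumber → Commute A HubbardWave0.spinZ →
        0 ≤ (ρ * fermionEmbed (PolySite.incl hΛ) (stabilityObs t U Λ A)).trace) →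
    lo ≤ ((ρ * hAvg t U a b).trace).re

/-- Fewer rows, same conclusion: an `LTIRectNode` bound is an `LTIRectGSNode` bound (so §5's dominance edges feed
this node too). -/
theorem LTIRectNode.gsNode {t U : ℝ} {a b : ℕ} {n lo : ℝ} (h : LTIRectNode t U a b n lo) : LTIRectGSNode t U a b n lo :=
  fun ρ h1 h2 h3 h4 _ _ => h ρ h1 h2 h3 h4

/-- `LTIRectGSNode` is monotone in the slot: a smaller constant is also a valid floor. -/
theorem LTIRectGSNode.mono {t U : ℝ} {a b : ℕ} {n lo lo' : ℝ} (h : LTIRectGSNode t U a b n lo) (hlo : lo' ≤ lo) :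
    LTIRectGSNode t U a b n lo' :=
  fun ρ h1 h2 h3 h4 h5 h6 => hlo.trans (h ρ h1 h2 h3 h4 h5 h6)

/- op-07's `re_expect_sum_numberOp` (the spin-resolved particle number of a window in a translation-invariant state) is the landed
`HubbardAlg.GSWindowNodeD4Sound.expect_sum_numberOp` (pub-hubbard #235, p323552 — identical statement; gate dedup), used below by name. -/

/-- **SOUNDNESS of the ground-state-class node (PROVED transport, `a, b ≥ 2`, `0 ≤ n < 2`, `U ≥ 0`)**:
`LTIRectGSNode t U a b n lo → lo ≤ e(t,U,n)`.  The window marginal of a torus limit `ω` of canonical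
`(N = ⌊n L²⌋∧even, S^z = 0)` ground states of the `L × L` tori is feasible for every row: the `LTIRectNode` rows as in
`LTIRectNode.tiStateNode`, the `S^z` rows by `ω(n_{0σ}) = n/2`, the stability rows by
`IsTorusLimitOf.localStability`; its objective value is `e(ω) = e(t,U,n)`. -/
theorem LTIRectGSNode.le_energyDensity2D {t U : ℝ} (hU : 0 ≤ U) {a b : ℕ} (ha : 2 ≤ a) (hb : 2 ≤ b) {n lo : ℝ}
    (hn0 : 0 ≤ n) (hn2 : n < 2) (h : LTIRectGSNode t U a b n lo) : lo ≤ energyDensity2D t U n := by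
  refine le_energyDensity2D_of_forall_torusLimit t hU hn0 hn2 fun ω ψ Ls hLs hω hti _ _ hgs hd hspin => ?_
  have key := h (ω.rdm (rectWindow a b)) (ω.rdm_posSemidef _) (ω.trace_rdm _) (windowLTI_rdm hti _)
    (by rw [ω.trace_rdm_mul, hti.re_expect_totalNumber, card_rectWindow', hd])
    (fun σ => by
      rw [ω.trace_rdm_mul, HubbardAlg.GSWindowNodeD4Sound.expect_sum_numberOp hti, hspin σ, ← Complex.ofReal_natCast, ← Complex.ofReal_mul,
        Complex.ofReal_re, card_rectWindow'])
    (fun Λ hΛ A hAN hAS => by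
      rw [ω.trace_rdm_mul, ω.compatible hΛ]
      exact InfVolFermionState.IsTorusLimitOf.localStability t U hω hLs hgs hAN hAS)
  rwa [ω.trace_rdm_mul, re_expect_hAvg hti ha hb] at key

/-- **Cell M3 at `t' = 0`**: a certified `LTIRectGSNode 1 8 a b (7/8) lo` is an `M3EnergyLowerRow 0 lo`. -/
theorem LTIRectGSNode.m3EnergyLowerRow {a b : ℕ} (ha : 2 ≤ a) (hb : 2 ≤ b) {lo : ℚ}
    (h : LTIRectGSNode 1 8 a b (7 / 8) lo) : M3EnergyLowerRow 0 lo :=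
  (M3EnergyLowerRow_zero_iff lo).2 (h.le_energyDensity2D (by norm_num) ha hb (by norm_num) (by norm_num))

/-- **Cell M2**: a certified `LTIRectGSNode 1 U a b 1 lo` is an `M2EnergyLowerRow U lo`. -/
theorem LTIRectGSNode.m2EnergyLowerRow {U : ℝ} (hU : 0 ≤ U) {a b : ℕ} (ha : 2 ≤ a) (hb : 2 ≤ b) {lo : ℚ}
    (h : LTIRectGSNode 1 U a b 1 lo) : M2EnergyLowerRow U lo :=
  h.le_energyDensity2D hU ha hb zero_le_one one_lt_two

end GroundStateClass

end Summit.Ventures.CertifiedManyBodySolver.Rows.RectMarginalNodes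

end
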